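import Summits.QuantumFields.YangMills.Theses.ThermalTraceWindow
import Summits.QuantumFields.YangMills.Theorems.FemtoTransferGapBounds
import HarnessLib

/-!
# `ThermalTraceWindow.GapQuenchesFemtoEntropyGlue` (glue of the K1 split, LINE g8-C of seat ym-idea-4) — PROVED

`TorusGapFromLimitGap → FewBodyEntropy → GapQuenchesFemtoEntropy`: if the finite torus's first zero-flux level tracks the limit-state gap,
`(λ₁/λ₀)^L ≤ β^c L^c e^{-θ m L}` (K1b), and the zero-flux thermal entropy is at most `C β^q L^p √((λ₁/λ₀)^L)` (K1a), then
`Z_phys(L×L³) ≤ (1 + C β^{q+c/2} L^{p+c/2} e^{-(θ/2) m L}) λ₀^L`, i.e. K1 with constants `(θ/2, C, q + c/2, p + c/2)`.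
Real arithmetic (`√(a² ) = a`, `rpow_add`) plus `levelValue_zero_su2Rep_pos`.

HONEST FRAMING: bookkeeping; no RG content, no summit.
-/

open Literature.MathematicalPhysics.QuantumLattice
open Summit.QuantumFields.YangMills.Theorems
open Summit.QuantumFields.YangMills.Theorems.FemtoTransferGap

namespace Summit.QuantumFields.YangMills.Theses.ThermalTraceWindow

/-- **The K1 split glue holds** (item: `GapQuenchesFemtoEntropyGlue`). -/
theorem gapQuenchesFemtoEntropyGlue_holds : GapQuenchesFemtoEntropyGlue := by
  unfold GapQuenchesFemtoEntropyGlue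
  intro hb ha
  obtain ⟨θ, c, hθ, β₁, hb⟩ := hb
  obtain ⟨C, q, p, hC, β₂, ha⟩ := ha
  refine ⟨θ / 2, C, q + c / 2, p + c / 2, by positivity, hC, max (max β₁ β₂) 1, ?_⟩
  intro β hβ m hm hμ L _ hL
  simp only [max_le_iff] at hβ
  obtain ⟨⟨hβ1, hβ2⟩, hβone⟩ := hβ
  have hβpos : 0 < β := by linarith
  have hLpos : (0 : ℝ) < L := by exact_mod_cast (show 0 < L by omega)
  have hx := hb β hβ1 m hm hμ L hL
  have hZ := ha β hβ2 L hL
  have hlam0 : 0 < levelValue su2Rep L β 0 := levelValue_zero_su2Rep_pos L β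
  -- √x ≤ β^{c/2} L^{c/2} e^{-(θ/2) m L}
  set y : ℝ := β ^ (c / 2) * (L : ℝ) ^ (c / 2) * Real.exp (-(θ / 2 * m * L)) with hy
  have hy0 : 0 ≤ y := by positivity
  have h1 : (β ^ (c / 2)) ^ 2 = β ^ c := by
    rw [← Real.rpow_natCast, ← Real.rpow_mul hβpos.le]; norm_num
  have h2 : ((L : ℝ) ^ (c / 2)) ^ 2 = (L : ℝ) ^ c := by
    rw [← Real.rpow_natCast, ← Real.rpow_mul hLpos.le]; norm_num
  have h3 : Real.exp (-(θ / 2 * m * L)) ^ 2 = Real.exp (-(θ * m * L)) := by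
    rw [sq, ← Real.exp_add]; ring_nf
  have hysq : y ^ 2 = β ^ c * (L : ℝ) ^ c * Real.exp (-(θ * m * L)) := by
    rw [hy, mul_pow, mul_pow, h1, h2, h3]
  have hsqrt : Real.sqrt ((levelValue su2Rep L β 1 / levelValue su2Rep L β 0) ^ L) ≤ y := by
    rw [show y = Real.sqrt (y ^ 2) by rw [Real.sqrt_sq hy0]]
    exact Real.sqrt_le_sqrt (hx.trans hysq.symm.le)
  have hpoly : 0 ≤ C * β ^ q * (L : ℝ) ^ p := by positivity
  calc TT.physTrace L β L
      ≤ (1 + C * β ^ q * (L : ℝ) ^ p * Real.sqrt ((levelValue su2Rep L β 1 / levelValue su2Rep L β 0) ^ L)) *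
          levelValue su2Rep L β 0 ^ L := hZ
    _ ≤ (1 + C * β ^ q * (L : ℝ) ^ p * y) * levelValue su2Rep L β 0 ^ L := by
        apply mul_le_mul_of_nonneg_right _ (pow_nonneg hlam0.le _)
        have := mul_le_mul_of_nonneg_left hsqrt hpoly
        linarith
    _ = (1 + C * β ^ (q + c / 2) * (L : ℝ) ^ (p + c / 2) * Real.exp (-(θ / 2 * m * L))) *
          levelValue su2Rep L β 0 ^ L := by
        rw [hy, Real.rpow_add hβpos, Real.rpow_add hLpos]; ring

end Summit.QuantumFields.YangMills.Theses.ThermalTraceWindow
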